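import Literature.Claims.NS.Nahiru2026
import Literature.Analysis.FunctionSpaces.SobolevShellScaling
import Literature.Analysis.FluidPDE.LerayHopfH1Test
import HarnessLib

/-!
# C178 `Nahiru2026` — SALVAGE (a) TRUE column: Proposition 7.2 (critical Gagliardo–Nirenberg bound on
# the shells `A(θρ, ρ)` with exact `ρ`-cancellation) HOLDS — `step_P72_holds : Step_P72`

Cell `ns-claims` (D-0090), lane ns-claims-salvage-p6 g5 (DISCHARGE column, RULINGS v1.51 (5) / v1.54 (3));
records-grade for the row (ADJUDICATED #163 «discharges — KNOWN RESULT», lead-1 g7 19:34:28Z, stands as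
lettered): the kernel twin of the ONE typed Step of `Literature/Claims/NS/Nahiru2026.lean` left without a
kernel object after rev 5 (refuter-7 g5 19:23:42Z, refuter-6 g5 19:35:30Z), so that every binder of the
print's chain `claimedTheorem_of_tools : Step_L22 → Step_P51_I1 → Step_C62 → Step_P72 → ClaimedTheorem` is
discharged. Text of record: Zenodo 19720004, `paper/paper.pdf` sha16 91cf176daea92805, Prop 7.2 (16)–(17)
p.11 l.74 – p.12 l.18 («‖v‖³_{L³(A(θρ,ρ))} ≤ C'_GN (CM)^a ρ^b D(ρ)^b + C'_GN (CM)³», `a = 3p/(6−p)`,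
`b = 3(3−p)/(6−p)`, from Lemma 7.1 = GN on the reference annulus rescaled by `ṽ(y) = v(ρy)` + (13)).

Proof given here (Lemma 7.1's route with the tree's tools): (i) the scale-invariant Sobolev inequality on
shells `‖v‖_{L⁶(A)} ≤ C_S (ρ⁻¹‖v‖_{L²(A)} + ‖∇v‖_{L²(A)})`, `C_S = C_S(θ)`
(`FunctionSpaces.exists_eLpNorm_six_le_shell_of_contDiff`: the open shell is a bounded Lipschitz domain,
Adams 1975 Lemma 5.10 on the unit shell, dilation), with `‖∇v‖_{op} ≤ |∇v|_{Frobenius}` so that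
`‖∇v‖_{L²(A)} ≤ D(ρ)^{1/2}`; (ii) Lebesgue interpolation `∫_A|v|³ ≤ (∫_A|v|^q)^{3/(6−q)}(∫_A|v|⁶)^{(3−q)/(6−q)}`
(`FluidPDE.lintegral_rpow_interpolate`); (iii) the Lorentz bound `Step_C62` at `r = q` and `r = 2`;
(iv) bookkeeping `‖v‖_{L^q}^a ≤ (C_q M)^a ρ^{a(3/q−1)} = (C_q M)^a ρ^b`,
`‖v‖_{L⁶}^{2b} ≤ (2C_S)^{2b}((C₂M)^{2b}ρ^{−b} + D^b)`, `a + 2b = 3` — the two terms of (17).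
Main results: `step_P72_of_C62 : Step_C62 → Step_P72` and `step_P72_holds : Step_P72`.

WHAT THIS IS NOT: not a claim about NS regularity or blow-up; not a claim about any author beyond the
typed locator.
-/

set_option linter.dupNamespace false

noncomputable section

open MeasureTheory Set Filter Metric Topology
open scoped ENNReal NNReal

namespace Summit.NavierStokesRegularity.NavierStokesRegularity.Theorems.Nahiru2026

open Literature.Analysis.FluidPDE Literature.Analysis.FunctionSpaces Literature.Claims.NS
open Literature.Claims.NS.Nahiru2026

/-! ### §1 Plumbing on the shells `A(θρ, ρ) = B_ρ ∖ B_{θρ}` -/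

/-- The skeleton's annulus is measurable. [cite: Nahiru2026, Notation 2.1 p.4 l.24–27] -/
theorem measurableSet_annulus (θ ρ : ℝ) : MeasurableSet (annulus θ ρ) :=
  measurableSet_ball.diff measurableSet_ball

/-- The annulus lies in the ball `B_ρ`, so it has finite volume. [cite: Nahiru2026, Notation 2.1 p.4 l.24–27] -/
theorem volume_annulus_lt_top (θ ρ : ℝ) : volume (annulus θ ρ) < ∞ :=
  (measure_mono (fun _ hx => hx.1 : annulus θ ρ ⊆ ball (0 : E3) ρ)).trans_lt measure_ball_lt_top

/-- A continuous field is bounded on the annulus. [cite: Nahiru2026, §2 p.4 l.47–50 (smooth `v`, no junk values)] -/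
theorem exists_bound_on_annulus {F : Type*} [NormedAddCommGroup F] {f : E3 → F} (hf : Continuous f)
    (θ ρ : ℝ) : ∃ K : ℝ, ∀ x ∈ annulus θ ρ, ‖f x‖ ≤ K := by
  obtain ⟨K, hK⟩ := (isCompact_closedBall (0 : E3) ρ).exists_bound_of_continuousOn hf.continuousOn
  exact ⟨K, fun x hx => hK x (ball_subset_closedBall hx.1)⟩

/-- A continuous field lies in every `L^p` of the annulus. [cite: Nahiru2026, §2 p.4 l.47–50 (smooth `v`, no junk values)] -/
theorem memLp_annulus_of_continuous {F : Type*} [NormedAddCommGroup F] {f : E3 → F} (hf : Continuous f)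
    (θ ρ : ℝ) (p : ℝ≥0∞) : MemLp f p (volume.restrict (annulus θ ρ)) := by
  haveI : IsFiniteMeasure (volume.restrict (annulus θ ρ)) :=
    isFiniteMeasure_restrict.2 (volume_annulus_lt_top θ ρ).ne
  obtain ⟨K, hK⟩ := exists_bound_on_annulus hf θ ρ
  have htop : MemLp f ∞ (volume.restrict (annulus θ ρ)) :=
    memLp_top_of_bound hf.aestronglyMeasurable K
      ((ae_restrict_iff' (measurableSet_annulus θ ρ)).2 (Eventually.of_forall hK))
  exact htop.mono_exponent le_top

/-- `∫_A ‖f‖^r < ∞` for a continuous field and `r ≥ 0`. [cite: Nahiru2026, §2 p.4 l.47–50 (smooth `v`, no junk values)] -/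
theorem lintegral_rpow_annulus_lt_top {F : Type*} [NormedAddCommGroup F] {f : E3 → F} (hf : Continuous f)
    (θ ρ : ℝ) {r : ℝ} (hr : 0 ≤ r) : ∫⁻ x in annulus θ ρ, ‖f x‖ₑ ^ r < ∞ := by
  obtain ⟨K, hK⟩ := exists_bound_on_annulus hf θ ρ
  have hK0 : 0 ≤ max K 0 := le_max_right _ _
  calc ∫⁻ x in annulus θ ρ, ‖f x‖ₑ ^ r
      ≤ ∫⁻ _ in annulus θ ρ, ENNReal.ofReal (max K 0) ^ r := by
        refine setLIntegral_mono measurable_const fun x hx => ?_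
        gcongr
        rw [← ofReal_norm]
        exact ENNReal.ofReal_le_ofReal ((hK x hx).trans (le_max_left _ _))
    _ = ENNReal.ofReal (max K 0) ^ r * volume (annulus θ ρ) := setLIntegral_const _ _
    _ < ∞ := ENNReal.mul_lt_top (ENNReal.rpow_lt_top_of_nonneg hr ENNReal.ofReal_ne_top)
        (volume_annulus_lt_top θ ρ)

/-- Real and extended integrals of `‖f‖^r` on the annulus agree for a continuous field (`r > 0`).
[cite: Nahiru2026, Prop 6.1 (12) p.10 (the quantities `‖f‖_{L^r(A)}`)] -/
theorem integral_rpow_annulus_eq_toReal {F : Type*} [NormedAddCommGroup F] {f : E3 → F}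
    (hf : Continuous f) (θ ρ : ℝ) {r : ℝ} (hr : 0 < r) :
    ∫ x in annulus θ ρ, ‖f x‖ ^ r = (∫⁻ x in annulus θ ρ, ‖f x‖ₑ ^ r).toReal := by
  have hmeas : AEStronglyMeasurable (fun x => ‖f x‖ ^ r) (volume.restrict (annulus θ ρ)) :=
    (hf.norm.aestronglyMeasurable.aemeasurable.pow_const r).aestronglyMeasurable
  rw [integral_eq_lintegral_of_nonneg_ae (Eventually.of_forall fun x => Real.rpow_nonneg
    (norm_nonneg _) _) hmeas]
  congr 1
  refine lintegral_congr fun x => ?_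
  rw [← ofReal_norm, ENNReal.ofReal_rpow_of_nonneg (norm_nonneg _) hr.le]

/-- `lrA r` is nonnegative. [cite: Nahiru2026, Prop 6.1 (12) p.10] -/
theorem lrA_nonneg (r θ : ℝ) (f : E3 → E3) (ρ : ℝ) : 0 ≤ lrA r θ f ρ := by
  unfold lrA
  exact Real.rpow_nonneg (integral_nonneg fun x => Real.rpow_nonneg (norm_nonneg _) _) _

/-- `lrA r ^ r = ∫_A ‖f‖^r` (`r > 0`). [cite: Nahiru2026, Prop 6.1 (12) p.10] -/
theorem lrA_rpow_self {r : ℝ} (hr : 0 < r) (θ : ℝ) (f : E3 → E3) (ρ : ℝ) :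
    lrA r θ f ρ ^ r = ∫ x in annulus θ ρ, ‖f x‖ ^ r := by
  unfold lrA
  rw [← Real.rpow_mul (integral_nonneg fun x => Real.rpow_nonneg (norm_nonneg _) _),
    one_div_mul_cancel hr.ne', Real.rpow_one]

/-- `D(ρ) ≥ 0`. [cite: Nahiru2026, Notation 2.1 p.4 l.43–46] -/
theorem D_nonneg (θ : ℝ) (v : E3 → E3) (ρ : ℝ) : 0 ≤ D θ v ρ :=
  integral_nonneg fun _ => frobeniusNormSq_nonneg _

/-- `M ≥ 0`. [cite: Nahiru2026, §2 p.4 l.18–23] -/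
theorem M_nonneg (v : E3 → E3) : 0 ≤ M v := ENNReal.toReal_nonneg

/-- `D(ρ)` as an extended integral, for a `C¹` field (the density `gradSq` is continuous and bounded
on the annulus). [cite: Nahiru2026, Notation 2.1 p.4 l.43–46] -/
theorem D_eq_toReal {v : E3 → E3} (hv : ContDiff ℝ 1 v) (θ ρ : ℝ) :
    D θ v ρ = (∫⁻ x in annulus θ ρ, ENNReal.ofReal (gradSq v x)).toReal ∧
      ∫⁻ x in annulus θ ρ, ENNReal.ofReal (gradSq v x) < ∞ := by
  have hc : Continuous (gradSq v) := continuous_frobeniusNormSq_fderiv hv one_ne_zero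
  have hint : IntegrableOn (gradSq v) (annulus θ ρ) volume := by
    have h := memLp_annulus_of_continuous (F := ℝ) hc θ ρ 1
    exact memLp_one_iff_integrable.1 h
  refine ⟨?_, ?_⟩
  · unfold D
    rw [integral_eq_lintegral_of_nonneg_ae (μ := volume.restrict (annulus θ ρ)) (f := gradSq v)
      (Eventually.of_forall fun x => (frobeniusNormSq_nonneg _ : 0 ≤ gradSq v x))
      hc.aestronglyMeasurable]
  · exact hint.setLIntegral_lt_top

/-- Operator norm versus Frobenius norm in `L²(A)`: `‖∇v‖_{L²(A)} ≤ (∫_A gradSq v)^{1/2}`.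
[cite: Nahiru2026, §2 p.4 l.38–46 (`|∇v|²` = the Frobenius density)] -/
theorem eLpNorm_fderiv_two_le (v : E3 → E3) (θ ρ : ℝ) :
    eLpNorm (fderiv ℝ v) 2 (volume.restrict (annulus θ ρ)) ≤
      (∫⁻ x in annulus θ ρ, ENNReal.ofReal (gradSq v x)) ^ (1 / 2 : ℝ) := by
  rw [eLpNorm_eq_lintegral_rpow_enorm_toReal two_ne_zero ENNReal.ofNat_ne_top, ENNReal.toReal_ofNat]
  gcongr with x
  rw [show (2 : ℝ) = ((2 : ℕ) : ℝ) by norm_num, ENNReal.rpow_natCast, ← ofReal_norm,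
    ← ENNReal.ofReal_pow (norm_nonneg _)]
  exact ENNReal.ofReal_le_ofReal (sq_opNorm_le_frobeniusNormSq (fderiv ℝ v x))

/-- **Interpolation** (RRS 2016 Thm 1.5 via the tree's `lintegral_rpow_interpolate`): for a continuous
field and `0 < q ≤ 3`: `∫_A ‖v‖³ ≤ (∫_A ‖v‖^q)^{3/(6−q)} (∫_A ‖v‖⁶)^{(3−q)/(6−q)}`.
[cite: Nahiru2026, Lemma 7.1 proof p.11 l.40–60 (interpolation between `L^p` and `L⁶`)] -/
theorem integral_rpow_three_le_interpolate {v : E3 → E3} (hv : Continuous v) (θ ρ : ℝ) {q : ℝ}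
    (hq0 : 0 < q) (hq3 : q ≤ 3) :
    ∫ x in annulus θ ρ, ‖v x‖ ^ (3 : ℝ) ≤
      (∫ x in annulus θ ρ, ‖v x‖ ^ q) ^ (3 / (6 - q)) *
        (∫ x in annulus θ ρ, ‖v x‖ ^ (6 : ℝ)) ^ ((3 - q) / (6 - q)) := by
  have hq6 : q < 6 := by linarith
  have hint := lintegral_rpow_interpolate (μ := volume.restrict (annulus θ ρ))
    (f := fun x => ‖v x‖ₑ) hv.aestronglyMeasurable.enorm hq0 hq6 hq3 (by norm_num : (3 : ℝ) ≤ 6)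
  rw [integral_rpow_annulus_eq_toReal hv θ ρ (by norm_num : (0 : ℝ) < 3),
    integral_rpow_annulus_eq_toReal hv θ ρ hq0,
    integral_rpow_annulus_eq_toReal hv θ ρ (by norm_num : (0 : ℝ) < 6),
    ENNReal.toReal_rpow, ENNReal.toReal_rpow, ← ENNReal.toReal_mul]
  have hfin : (∫⁻ x in annulus θ ρ, ‖v x‖ₑ ^ q) ^ (3 / (6 - q)) *
      (∫⁻ x in annulus θ ρ, ‖v x‖ₑ ^ (6 : ℝ)) ^ ((3 - q) / (6 - q)) ≠ ∞ := by
    refine ENNReal.mul_ne_top ?_ ?_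
    · exact ENNReal.rpow_ne_top_of_nonneg (by positivity : (0 : ℝ) ≤ 3 / (6 - q))
        (lintegral_rpow_annulus_lt_top hv θ ρ hq0.le).ne
    · exact ENNReal.rpow_ne_top_of_nonneg (div_nonneg (by linarith) (by linarith))
        (lintegral_rpow_annulus_lt_top hv θ ρ (by norm_num)).ne
  have h3 : (6 : ℝ) - 3 = 3 := by norm_num
  rw [h3] at hint
  exact ENNReal.toReal_mono hfin hint


/-- `(x + y)^s ≤ 2^s (x^s + y^s)` for `x, y, s ≥ 0`. [folklore] -/
private theorem add_rpow_le_two_rpow_mul {x y s : ℝ} (hx : 0 ≤ x) (hy : 0 ≤ y) (hs : 0 ≤ s) :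
    (x + y) ^ s ≤ (2 : ℝ) ^ s * (x ^ s + y ^ s) := by
  have hxs : 0 ≤ x ^ s := Real.rpow_nonneg hx s
  have hys : 0 ≤ y ^ s := Real.rpow_nonneg hy s
  rcases le_total x y with hxy | hxy
  · calc (x + y) ^ s ≤ (2 * y) ^ s := Real.rpow_le_rpow (by positivity) (by linarith) hs
      _ = (2 : ℝ) ^ s * y ^ s := Real.mul_rpow (by norm_num) hy
      _ ≤ (2 : ℝ) ^ s * (x ^ s + y ^ s) := by gcongr; linarith
  · calc (x + y) ^ s ≤ (2 * x) ^ s := Real.rpow_le_rpow (by positivity) (by linarith) hs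
      _ = (2 : ℝ) ^ s * x ^ s := Real.mul_rpow (by norm_num) hx
      _ ≤ (2 : ℝ) ^ s * (x ^ s + y ^ s) := by gcongr; linarith

/-- `lrA r ^ (r s) = (∫_A ‖f‖^r)^s` (`r > 0`). [cite: Nahiru2026, Prop 6.1 (12) p.10] -/
theorem lrA_rpow_mul {r : ℝ} (hr : 0 < r) (s θ : ℝ) (f : E3 → E3) (ρ : ℝ) :
    lrA r θ f ρ ^ (r * s) = (∫ x in annulus θ ρ, ‖f x‖ ^ r) ^ s := by
  rw [Real.rpow_mul (lrA_nonneg r θ f ρ), lrA_rpow_self hr]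

/-! ### §4 Proposition 7.2 from the annular Sobolev inequality and the Lorentz bound -/

/-- **The GN step (Lemma 7.1 rescaled + (13)), abstract form**: if on every shell `A(θρ, ρ)` the
scale-invariant Sobolev inequality `‖v‖_{L⁶(A)} ≤ C_S (ρ⁻¹‖v‖_{L²(A)} + D(ρ)^{1/2})` holds for `C¹`
fields (hypothesis `hS`, supplied below by `FunctionSpaces/SobolevShellScaling`), then the Lorentz
bound `Step_C62` implies `Step_P72`: interpolation `L³ ⊂ (L^q, L⁶)`, then
`‖v‖_{L^q}^a ≤ (C_q M)^a ρ^b`, `‖v‖_{L⁶}^{2b} ≤ (2C_S)^{2b}((C₂M)^{2b}ρ^{−b} + D^b)`, `a + 2b = 3`.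
[cite: Nahiru2026, Prop 7.2 (16)–(17) p.11 l.74 – p.12 l.18; Lemma 7.1 (14)–(15) p.11 l.17–72] -/
theorem step_P72_of_sobolev_of_C62
    (hS : ∀ θ : ℝ, 0 < θ → θ < 1 → ∃ CS : ℝ, 0 ≤ CS ∧ ∀ ρ : ℝ, 0 < ρ → ∀ v : E3 → E3,
      ContDiff ℝ 1 v → lrA 6 θ v ρ ≤ CS * (ρ⁻¹ * lrA 2 θ v ρ + D θ v ρ ^ (1 / 2 : ℝ)))
    (hC62 : Step_C62) : Step_P72 := by
  intro θ hθ0 hθ1 q hq1 hq3 v hv hweak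
  obtain ⟨CS, hCS0, hCS⟩ := hS θ hθ0 hθ1
  obtain ⟨C2, hC20, hC2⟩ := hC62 θ hθ0 hθ1 2 two_pos (by norm_num)
  obtain ⟨Cq, hCq0, hCq⟩ := hC62 θ hθ0 hθ1 q (by linarith) hq3
  set a : ℝ := 3 * q / (6 - q) with ha_def
  set b : ℝ := 3 * (3 - q) / (6 - q) with hb_def
  have h6q : 0 < 6 - q := by linarith
  have hq0 : 0 < q := by linarith
  have ha0 : 0 < a := by rw [ha_def]; positivity
  have hb0 : 0 < b := by rw [hb_def]; exact div_pos (by linarith) h6q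
  have hab : a + 2 * b = 3 := by
    rw [ha_def, hb_def]; field_simp; ring
  have hqa : q * (3 / (6 - q)) = a := by rw [ha_def]; ring
  have hqa' : (3 / q - 1) * a = b := by
    rw [ha_def, hb_def]; field_simp
  have h6b : 6 * ((3 - q) / (6 - q)) = 2 * b := by rw [hb_def]; ring
  have hhalf : (1 / 2 : ℝ) * (2 * b) = b := by ring
  have hneg : (-(1 / 2 : ℝ)) * (2 * b) = -b := by ring
  set K : ℝ := Cq ^ a * (2 * CS) ^ (2 * b) with hK_def
  have hK0 : 0 ≤ K := by positivity
  refine ⟨K * max (C2 ^ (2 * b)) 1, by positivity, fun ρ hρ => ?_⟩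
  have hv1 : ContDiff ℝ 1 v := hv.of_le (by exact_mod_cast le_top)
  have hvc : Continuous v := hv.continuous
  set m : ℝ := M v with hm_def
  have hm0 : 0 ≤ m := M_nonneg v
  set Dρ : ℝ := D θ v ρ with hD_def
  have hD0 : 0 ≤ Dρ := D_nonneg θ v ρ
  have hq_b : lrA q θ v ρ ≤ Cq * m * ρ ^ (3 / q - 1) := hCq v hweak ρ hρ
  have h2_b : lrA 2 θ v ρ ≤ C2 * m * ρ ^ (1 / 2 : ℝ) := by
    have := hC2 v hweak ρ hρ; norm_num at this; exact this
  have h6_b : lrA 6 θ v ρ ≤ CS * (ρ⁻¹ * lrA 2 θ v ρ + Dρ ^ (1 / 2 : ℝ)) := hCS ρ hρ v hv1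
  have hint := integral_rpow_three_le_interpolate hvc θ ρ hq0 hq3.le
  have hL : lrA 3 θ v ρ ^ 3 = ∫ x in annulus θ ρ, ‖v x‖ ^ (3 : ℝ) := by
    rw [show (lrA 3 θ v ρ ^ 3 : ℝ) = lrA 3 θ v ρ ^ (3 : ℝ) by norm_cast,
      lrA_rpow_self (by norm_num : (0 : ℝ) < 3)]
  have hP : (∫ x in annulus θ ρ, ‖v x‖ ^ q) ^ (3 / (6 - q)) ≤ Cq ^ a * m ^ a * ρ ^ b := by
    rw [← lrA_rpow_mul hq0, hqa]
    calc lrA q θ v ρ ^ a ≤ (Cq * m * ρ ^ (3 / q - 1)) ^ a :=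
          Real.rpow_le_rpow (lrA_nonneg q θ v ρ) hq_b ha0.le
      _ = Cq ^ a * m ^ a * ρ ^ b := by
          rw [Real.mul_rpow (by positivity) (Real.rpow_nonneg hρ.le _), Real.mul_rpow hCq0 hm0,
            ← Real.rpow_mul hρ.le, hqa']
  have hQ : (∫ x in annulus θ ρ, ‖v x‖ ^ (6 : ℝ)) ^ ((3 - q) / (6 - q)) ≤
      (2 * CS) ^ (2 * b) * (C2 ^ (2 * b) * m ^ (2 * b) * ρ ^ (-b) + Dρ ^ b) := by
    rw [← lrA_rpow_mul (by norm_num : (0 : ℝ) < 6), h6b]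
    have hX0 : 0 ≤ C2 * m * ρ ^ (-(1 / 2 : ℝ)) := by positivity
    have hY0 : 0 ≤ Dρ ^ (1 / 2 : ℝ) := Real.rpow_nonneg hD0 _
    have h6' : lrA 6 θ v ρ ≤ CS * (C2 * m * ρ ^ (-(1 / 2 : ℝ)) + Dρ ^ (1 / 2 : ℝ)) := by
      refine h6_b.trans ?_
      have hρ2 : ρ⁻¹ * (C2 * m * ρ ^ (1 / 2 : ℝ)) = C2 * m * ρ ^ (-(1 / 2 : ℝ)) := by
        rw [show (ρ⁻¹ : ℝ) = ρ ^ (-(1 : ℝ)) by rw [Real.rpow_neg_one], mul_comm, mul_assoc,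
          ← Real.rpow_add hρ]
        norm_num
      have : ρ⁻¹ * lrA 2 θ v ρ ≤ C2 * m * ρ ^ (-(1 / 2 : ℝ)) := by
        rw [← hρ2]; exact mul_le_mul_of_nonneg_left h2_b (inv_nonneg.2 hρ.le)
      gcongr
    calc lrA 6 θ v ρ ^ (2 * b)
        ≤ (CS * (C2 * m * ρ ^ (-(1 / 2 : ℝ)) + Dρ ^ (1 / 2 : ℝ))) ^ (2 * b) :=
          Real.rpow_le_rpow (lrA_nonneg 6 θ v ρ) h6' (by positivity)
      _ = CS ^ (2 * b) * (C2 * m * ρ ^ (-(1 / 2 : ℝ)) + Dρ ^ (1 / 2 : ℝ)) ^ (2 * b) :=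
          Real.mul_rpow hCS0 (add_nonneg hX0 hY0)
      _ ≤ CS ^ (2 * b) * ((2 : ℝ) ^ (2 * b) *
            ((C2 * m * ρ ^ (-(1 / 2 : ℝ))) ^ (2 * b) + (Dρ ^ (1 / 2 : ℝ)) ^ (2 * b))) := by
          gcongr
          exact add_rpow_le_two_rpow_mul hX0 hY0 (by positivity)
      _ = (2 * CS) ^ (2 * b) * (C2 ^ (2 * b) * m ^ (2 * b) * ρ ^ (-b) + Dρ ^ b) := by
          rw [Real.mul_rpow (by norm_num) hCS0, Real.mul_rpow (by positivity) (Real.rpow_nonneg hρ.le _),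
            Real.mul_rpow hC20 hm0, ← Real.rpow_mul hρ.le, ← Real.rpow_mul hD0, hneg, hhalf]
          ring
  have hm3 : m ^ a * m ^ (2 * b) = m ^ 3 := by
    rw [← Real.rpow_add' hm0 (by rw [hab]; norm_num), hab]
    norm_cast
  have hρ0 : ρ ^ b * ρ ^ (-b) = 1 := by
    rw [← Real.rpow_add hρ, add_neg_cancel, Real.rpow_zero]
  have hI0 : 0 ≤ (∫ x in annulus θ ρ, ‖v x‖ ^ (6 : ℝ)) ^ ((3 - q) / (6 - q)) :=
    Real.rpow_nonneg (integral_nonneg fun x => Real.rpow_nonneg (norm_nonneg _) _) _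
  have hmax1 : K ≤ K * max (C2 ^ (2 * b)) 1 := le_mul_of_one_le_right hK0 (le_max_right _ _)
  have hmax2 : K * C2 ^ (2 * b) ≤ K * max (C2 ^ (2 * b)) 1 :=
    mul_le_mul_of_nonneg_left (le_max_left _ _) hK0
  have hT1 : 0 ≤ m ^ a * ρ ^ b * Dρ ^ b := by positivity
  have hT2 : 0 ≤ m ^ 3 := by positivity
  rw [hL]
  calc ∫ x in annulus θ ρ, ‖v x‖ ^ (3 : ℝ)
      ≤ (∫ x in annulus θ ρ, ‖v x‖ ^ q) ^ (3 / (6 - q)) *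
          (∫ x in annulus θ ρ, ‖v x‖ ^ (6 : ℝ)) ^ ((3 - q) / (6 - q)) := hint
    _ ≤ (Cq ^ a * m ^ a * ρ ^ b) *
          ((2 * CS) ^ (2 * b) * (C2 ^ (2 * b) * m ^ (2 * b) * ρ ^ (-b) + Dρ ^ b)) :=
        mul_le_mul hP hQ hI0 (by positivity)
    _ = K * C2 ^ (2 * b) * (m ^ a * m ^ (2 * b)) * (ρ ^ b * ρ ^ (-b)) +
          K * (m ^ a * ρ ^ b * Dρ ^ b) := by rw [hK_def]; ring
    _ = K * C2 ^ (2 * b) * m ^ 3 + K * (m ^ a * ρ ^ b * Dρ ^ b) := by rw [hm3, hρ0, mul_one]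
    _ ≤ K * max (C2 ^ (2 * b)) 1 * m ^ 3 + K * max (C2 ^ (2 * b)) 1 * (m ^ a * ρ ^ b * Dρ ^ b) := by
        gcongr
    _ = K * max (C2 ^ (2 * b)) 1 * M v ^ (3 * q / (6 - q)) * ρ ^ (3 * (3 - q) / (6 - q)) *
            D θ v ρ ^ (3 * (3 - q) / (6 - q)) + K * max (C2 ^ (2 * b)) 1 * M v ^ 3 := by
        rw [hm_def, hD_def, ha_def, hb_def]; ring


/-! ### §5 The annular Sobolev inequality in the skeleton's real vocabulary, and the theorem -/

/-- The skeleton's annulus `B_ρ ∖ B_{θρ}` and the open shell `{θρ < |x| < ρ}` carry the same restricted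
Lebesgue measure (they differ by a subset of the sphere `|x| = θρ`, a null set).
[cite: Nahiru2026, Notation 2.1 p.4 l.24–27] -/
theorem restrict_annulus_eq_restrict_shell (θ ρ : ℝ) :
    volume.restrict (annulus θ ρ) =
      volume.restrict (((shell (0 : E3) (θ * ρ) ρ : TopologicalSpace.Opens E3)) : Set E3) := by
  refine Measure.restrict_congr_set ?_
  refine (ae_eq_set).2 ⟨?_, ?_⟩
  · refine measure_mono_null (t := sphere (0 : E3) (θ * ρ)) ?_ (Measure.addHaar_sphere volume 0 _)
    intro x hx
    obtain ⟨⟨hxρ, hxθ⟩, hns⟩ := hx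
    rw [coe_shell, mem_inter_iff, not_and, mem_compl_iff, not_not] at hns
    have h1 := hns hxρ
    rw [mem_closedBall, dist_zero_right] at h1
    rw [mem_ball, dist_zero_right, not_lt] at hxθ
    rw [mem_sphere, dist_zero_right]
    exact le_antisymm h1 hxθ
  · have hsub : (((shell (0 : E3) (θ * ρ) ρ : TopologicalSpace.Opens E3)) : Set E3) ⊆ annulus θ ρ := by
      intro x hx
      rw [coe_shell] at hx
      exact ⟨hx.1, fun h => hx.2 (ball_subset_closedBall h)⟩
    exact measure_mono_null (fun x hx => (hx.2 (hsub hx.1)).elim) measure_empty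

/-- `lrA p θ v ρ` is the real `L^p(A)` norm: `= (eLpNorm v p (vol⌊A))` for a continuous field
(`0 < p < ∞`). [cite: Nahiru2026, Prop 6.1 (12) p.10] -/
theorem lrA_eq_toReal_eLpNorm {v : E3 → E3} (hv : Continuous v) (θ ρ : ℝ) {p : ℝ≥0∞} (hp0 : p ≠ 0)
    (hpt : p ≠ ∞) : lrA p.toReal θ v ρ = (eLpNorm v p (volume.restrict (annulus θ ρ))).toReal := by
  have hr : 0 < p.toReal := ENNReal.toReal_pos hp0 hpt
  unfold lrA
  rw [integral_rpow_annulus_eq_toReal hv θ ρ hr, eLpNorm_eq_lintegral_rpow_enorm_toReal hp0 hpt,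
    ENNReal.toReal_rpow]

/-- **The scale-invariant Sobolev inequality on the shells `A(θρ, ρ)` of `ℝ³` in the skeleton's
vocabulary** (Lemma 7.1's Sobolev input, rescaled): for `0 < θ < 1` there is `C_S = C_S(θ)` with
`‖v‖_{L⁶(A)} ≤ C_S (ρ⁻¹ ‖v‖_{L²(A)} + D(ρ)^{1/2})` for every `ρ > 0` and every `C¹` field — from
`FunctionSpaces.exists_eLpNorm_six_le_shell_of_contDiff` (Adams 1975 Lemma 5.10 on the unit shell, a
bounded Lipschitz domain, and the dilation `x = ρy`), the operator norm of `∇v` being dominated by the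
Frobenius density `gradSq`. [cite: Nahiru2026, Lemma 7.1 (14) p.11 l.17–39] [cite: Adams1975, Lemma 5.10] -/
theorem annular_sobolev_six (θ : ℝ) (hθ0 : 0 < θ) (hθ1 : θ < 1) :
    ∃ CS : ℝ, 0 ≤ CS ∧ ∀ ρ : ℝ, 0 < ρ → ∀ v : E3 → E3, ContDiff ℝ 1 v →
      lrA 6 θ v ρ ≤ CS * (ρ⁻¹ * lrA 2 θ v ρ + D θ v ρ ^ (1 / 2 : ℝ)) := by
  obtain ⟨C, hC⟩ := exists_eLpNorm_six_le_shell_of_contDiff (E := E3) (F := E3)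
    finrank_euclideanSpace_fin hθ0 hθ1
  refine ⟨C, C.coe_nonneg, fun ρ hρ v hv => ?_⟩
  set μA : Measure E3 := volume.restrict (annulus θ ρ) with hμA
  have hμ : volume.restrict (((shell (0 : E3) (θ * ρ) ρ : TopologicalSpace.Opens E3)) : Set E3) = μA :=
    (restrict_annulus_eq_restrict_shell θ ρ).symm
  have hvc : Continuous v := hv.continuous
  have hDc : Continuous (fderiv ℝ v) := hv.continuous_fderiv one_ne_zero
  have hf2 : MemLp v 2 μA := memLp_annulus_of_continuous hvc θ ρ 2
  have hDf2 : MemLp (fderiv ℝ v) 2 μA := memLp_annulus_of_continuous hDc θ ρ 2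
  have key := hC 0 ρ hρ v hv (by rw [hμ]; exact hf2) (by rw [hμ]; exact hDf2)
  rw [hμ] at key
  set G : ℝ≥0∞ := ∫⁻ x in annulus θ ρ, ENNReal.ofReal (gradSq v x) with hG
  obtain ⟨hDG, hGfin⟩ := D_eq_toReal hv θ ρ
  have key' : eLpNorm v 6 μA ≤ C * ((ENNReal.ofReal ρ)⁻¹ * eLpNorm v 2 μA + G ^ (1 / 2 : ℝ)) := by
    refine key.trans ?_
    gcongr
    exact eLpNorm_fderiv_two_le v θ ρ
  have h2fin : eLpNorm v 2 μA ≠ ∞ := hf2.eLpNorm_ne_top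
  have hρinv : (ENNReal.ofReal ρ)⁻¹ ≠ ∞ := ENNReal.inv_ne_top.2 (ENNReal.ofReal_pos.2 hρ).ne'
  have hG12 : G ^ (1 / 2 : ℝ) ≠ ∞ := ENNReal.rpow_ne_top_of_nonneg (by norm_num) hGfin.ne
  have hRfin : (C : ℝ≥0∞) * ((ENNReal.ofReal ρ)⁻¹ * eLpNorm v 2 μA + G ^ (1 / 2 : ℝ)) ≠ ∞ :=
    ENNReal.mul_ne_top ENNReal.coe_ne_top
      (ENNReal.add_ne_top.2 ⟨ENNReal.mul_ne_top hρinv h2fin, hG12⟩)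
  have hreal := ENNReal.toReal_mono hRfin key'
  rw [ENNReal.toReal_mul, ENNReal.toReal_add (ENNReal.mul_ne_top hρinv h2fin) hG12, ENNReal.toReal_mul,
    ENNReal.toReal_inv, ENNReal.toReal_ofReal hρ.le, ← ENNReal.toReal_rpow, ← hDG, ENNReal.coe_toReal]
    at hreal
  have e6 : lrA 6 θ v ρ = (eLpNorm v 6 μA).toReal := by
    have := lrA_eq_toReal_eLpNorm hvc θ ρ (p := 6) (by norm_num) (by norm_num)
    rwa [ENNReal.toReal_ofNat] at this
  have e2 : lrA 2 θ v ρ = (eLpNorm v 2 μA).toReal := by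
    have := lrA_eq_toReal_eLpNorm hvc θ ρ (p := 2) (by norm_num) (by norm_num)
    rwa [ENNReal.toReal_ofNat] at this
  rw [e6, e2]
  exact hreal

/-- **Proposition 7.2 follows from Corollary 6.2** — the print's derivation (Lemma 7.1 rescaled, then
(13) for `‖ṽ‖_{L^p(A(θ,1))}`), with the tree's annular Sobolev inequality in place of the printed
"GN on the bounded John domain". [cite: Nahiru2026, Prop 7.2 proof p.11 l.82 – p.12 l.18] -/
theorem step_P72_of_C62 : Step_C62 → Step_P72 :=
  step_P72_of_sobolev_of_C62 annular_sobolev_six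

/-- **Step 4 — Proposition 7.2 (critical GN bound with exact `ρ`-cancellation) (16)–(17) p.11 HOLDS**:
for `θ ∈ (0,1)`, `q ∈ (3/2, 3)` and every smooth `v ∈ L^{3,∞}(ℝ³)` there is `C` with
`‖v‖³_{L³(A(θρ,ρ))} ≤ C M^{3q/(6−q)} ρ^{3(3−q)/(6−q)} D(ρ)^{3(3−q)/(6−q)} + C M³` for every `ρ > 0` —
the kernel twin of `Literature.Claims.NS.Nahiru2026.Step_P72`, by `step_P72_of_C62` and the in-tree
discharge `step_C62_holds` of the Lorentz bound (13). With it every binder of the skeleton's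
`claimedTheorem_of_tools : Step_L22 → Step_P51_I1 → Step_C62 → Step_P72 → ClaimedTheorem` has a kernel
object. [cite: Nahiru2026, Prop 7.2 (16)–(17) p.11 l.74 – p.12 l.18] -/
theorem step_P72_holds : Step_P72 :=
  step_P72_of_C62 step_C62_holds

end Summit.NavierStokesRegularity.NavierStokesRegularity.Theorems.Nahiru2026

end
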